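import Summits.RiemannHypothesis.RiemannHypothesis.Theorems.LiAsymptoticDefs
import Literature.NumberTheory.LFunctions.RiemannSiegelThetaBounds
import Literature.NumberTheory.LFunctions.RiemannSiegelFacts
import Literature.NumberTheory.LFunctions.SchoenfeldZeroSumsExplicit
import HarnessLib

/-!
# RiemannHypothesis / LiAsymptotic — crux K2 `LiSmoothMainTerm`, stub K2b: replacing `ϑ'` and `θ` (RH-FREE)

RH-FREE [rh-li-prover].  Route `Theses/LiAsymptotic.lean` (rung L-P(P1⁺) «Li asymptotic law, quadratic range»,
cell `pub/rh-li`, theory memo `theory/TARGETS.md` §11.2 STEP 6 (6a)(6b)), item `LiSmoothMainTerm`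
(stmt-RiemannHypothesis-19162), registered birth stub `stub_replace` (K2b) VERBATIM: for `n ≥ 100` and `T' ≥ n²`,

  `|(2/π)∫_{√n}^{T'} f_n(t) ϑ'(t) dt − (1/π)∫_{√n}^{T'} (1 − cos(n/t)) log(t/2π) dt| ≤ 1.28 log n + 0.33`,

`f_n(t) = liWindowWeight n t = 1 − cos(nθ(t))`, `θ(t) = 2 arctan(1/2t)`, `ϑ' = riemannSiegelThetaDeriv`.
Proof: pointwise `2 f_n ϑ' − (1 − cos(n/t)) log(t/2π) = 2 f_n (ϑ' − ½ log(t/2π)) + (f_n − (1 − cos(n/t))) log(t/2π)`;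
(6a) `|ϑ' − ½ log(t/2π)| ≤ 2/t` (`abs_riemannSiegelThetaDeriv_sub_log_le`) against `f_n ≤ 2` on `[√n, n/2]` and
`f_n ≤ n²/(2t²)` on `[n/2, T']` (`θ(t) ≤ 1/t`): `≤ 8 log(√n/2) + 4`; (6b) `0 ≤ 1/t − θ(t) ≤ 1/(12t³)`
(`x − x³/3 ≤ arctan x ≤ x`), so `|cos(n/t) − cos(nθ)| ≤ n/(12t³)` against `0 ≤ log(t/2π) ≤ log t`:
`≤ (n/12)∫_{√n}^∞ log t/t³ = (log n + 1)/48`; total `(4 + 1/48)/π · log n − 0.48`.  Nothing here bears on the truth of RH.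
-/

noncomputable section

-- D-0017: `Summit.<S>.<S>.…` is the designed namespace of a single-problem summit.
set_option linter.dupNamespace false

open MeasureTheory intervalIntegral Set
open scoped Real Interval

namespace Summit.RiemannHypothesis.RiemannHypothesis.Theorems.LiTheory

open Literature.NumberTheory.LFunctions Literature.NumberTheory.LFunctions.SchoenfeldBound

namespace SmoothReplace

/-! ### The zero angle against `1/t` -/

/-- `x − x³/3 ≤ arctan x` for `x ≥ 0` (the map `x ↦ arctan x − x + x³/3` has derivative `x⁴/(1 + x²) ≥ 0`). -/
theorem sub_cube_le_arctan {x : ℝ} (hx : 0 ≤ x) : x - x ^ 3 / 3 ≤ Real.arctan x := by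
  have hderiv : ∀ y : ℝ, HasDerivAt (fun y : ℝ ↦ Real.arctan y - y + y ^ 3 / 3) (y ^ 4 / (1 + y ^ 2)) y := by
    intro y
    have h := ((Real.hasDerivAt_arctan y).sub (hasDerivAt_id y)).add ((hasDerivAt_pow 3 y).div_const 3)
    refine h.congr_deriv ?_
    have : (1 : ℝ) + y ^ 2 ≠ 0 := by positivity
    push_cast
    field_simp
    ring
  have hmono : Monotone (fun y : ℝ ↦ Real.arctan y - y + y ^ 3 / 3) :=
    monotone_of_deriv_nonneg (fun y ↦ (hderiv y).differentiableAt) fun y ↦ by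
      rw [(hderiv y).deriv]; positivity
  have := hmono hx
  simp only [Real.arctan_zero] at this
  linarith

/-- `0 ≤ 1/t − θ(t) ≤ 1/(12t³)` for `t > 0` (`θ(t) = 2 arctan(1/2t)`). -/
theorem inv_sub_liZeroAngle_bounds {t : ℝ} (ht : 0 < t) :
    0 ≤ 1 / t - liZeroAngle t ∧ 1 / t - liZeroAngle t ≤ 1 / (12 * t ^ 3) := by
  have hx : 0 ≤ 1 / (2 * t) := by positivity
  have hup : Real.arctan (1 / (2 * t)) ≤ 1 / (2 * t) := by
    have h := Real.le_tan (Real.arctan_nonneg.2 hx) (Real.arctan_lt_pi_div_two _)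
    rwa [Real.tan_arctan] at h
  have hlo := sub_cube_le_arctan hx
  unfold liZeroAngle
  constructor
  · have : 2 * (1 / (2 * t)) = 1 / t := by field_simp
    linarith
  · have e : 1 / t - 2 * (1 / (2 * t) - (1 / (2 * t)) ^ 3 / 3) = 1 / (12 * t ^ 3) := by
      field_simp; ring
    linarith

/-- `0 ≤ θ(t) ≤ 1/t` for `t > 0`. -/
theorem liZeroAngle_bounds {t : ℝ} (ht : 0 < t) : 0 ≤ liZeroAngle t ∧ liZeroAngle t ≤ 1 / t :=
  ⟨by unfold liZeroAngle; exact mul_nonneg (by norm_num) (Real.arctan_nonneg.2 (by positivity)),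
    by linarith [(inv_sub_liZeroAngle_bounds ht).1]⟩

/-- `f_n(t) ≤ n²/(2t²)` for `t > 0` (`1 − cos y ≤ y²/2`, `θ ≤ 1/t`). -/
theorem liWindowWeight_le_sq (n : ℕ) {t : ℝ} (ht : 0 < t) : liWindowWeight n t ≤ (n : ℝ) ^ 2 / (2 * t ^ 2) := by
  unfold liWindowWeight
  have h := Real.one_sub_sq_div_two_le_cos (x := n * liZeroAngle t)
  obtain ⟨h0, h1⟩ := liZeroAngle_bounds ht
  have hn : (0 : ℝ) ≤ n := n.cast_nonneg
  have h2 : (n * liZeroAngle t) ^ 2 ≤ (n : ℝ) ^ 2 / t ^ 2 := by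
    rw [mul_pow, div_eq_mul_one_div, one_div, ← inv_pow]
    exact mul_le_mul_of_nonneg_left (pow_le_pow_left₀ h0 (by rwa [one_div] at h1) 2) (sq_nonneg _)
  have e : (n : ℝ) ^ 2 / (2 * t ^ 2) = (n : ℝ) ^ 2 / t ^ 2 / 2 := by ring
  rw [e]; linarith

/-- `0 ≤ f_n ≤ 2`. -/
theorem liWindowWeight_mem (n : ℕ) (t : ℝ) : 0 ≤ liWindowWeight n t ∧ liWindowWeight n t ≤ 2 :=
  ⟨by unfold liWindowWeight; linarith [Real.cos_le_one (n * liZeroAngle t)],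
    by unfold liWindowWeight; linarith [Real.neg_one_le_cos (n * liZeroAngle t)]⟩

/-- `|f_n(t) − (1 − cos(n/t))| ≤ n/(12t³)` for `t > 0` (cos is 1-Lipschitz). -/
theorem abs_liWindowWeight_sub_model_le (n : ℕ) {t : ℝ} (ht : 0 < t) :
    |liWindowWeight n t - (1 - Real.cos (n / t))| ≤ (n : ℝ) / (12 * t ^ 3) := by
  unfold liWindowWeight
  obtain ⟨h0, h1⟩ := inv_sub_liZeroAngle_bounds ht
  have hn : (0 : ℝ) ≤ n := n.cast_nonneg
  have e : 1 - Real.cos (n * liZeroAngle t) - (1 - Real.cos (n / t)) = Real.cos (n / t) - Real.cos (n * liZeroAngle t) := by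
    ring
  rw [e]
  refine (Real.abs_cos_sub_cos_le _ _).trans ?_
  rw [show (n : ℝ) / t - n * liZeroAngle t = n * (1 / t - liZeroAngle t) by ring, abs_mul, Nat.abs_cast,
    abs_of_nonneg h0]
  calc (n : ℝ) * (1 / t - liZeroAngle t) ≤ n * (1 / (12 * t ^ 3)) := mul_le_mul_of_nonneg_left h1 hn
    _ = (n : ℝ) / (12 * t ^ 3) := by ring

/-! ### Continuity of the integrands on `(0, ∞)` -/

/-- `f_n` is continuous away from `0`. -/
theorem continuousOn_liWindowWeight (n : ℕ) {s : Set ℝ} (hs : ∀ t ∈ s, t ≠ 0) :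
    ContinuousOn (liWindowWeight n) s := fun t ht ↦
  (hasDerivAt_liWindowWeight n (hs t ht)).continuousAt.continuousWithinAt

/-- The replacement integrand `A(t) = 2 f_n (ϑ' − ½ log(t/2π))` is continuous on `[a, b]`, `a > 0`. -/
theorem continuousOn_A (n : ℕ) {a b : ℝ} (ha : 0 < a) :
    ContinuousOn (fun t ↦ 2 * liWindowWeight n t * (riemannSiegelThetaDeriv t - Real.log (t / (2 * π)) / 2))
      (Icc a b) := by
  have hne : ∀ t ∈ Icc a b, t ≠ 0 := fun t ht ↦ by linarith [ht.1]
  have hf := continuousOn_liWindowWeight n hne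
  have hϑ : Continuous riemannSiegelThetaDeriv := continuous_riemannSiegelThetaDeriv_holds
  have hlog : ContinuousOn (fun t : ℝ ↦ Real.log (t / (2 * π)) / 2) (Icc a b) := by
    refine continuousOn_of_forall_continuousAt fun t ht ↦ ?_
    have : t / (2 * π) ≠ 0 := by have : 0 < t := by linarith [ht.1]
                                 positivity
    fun_prop (disch := assumption)
  exact (continuousOn_const.mul hf).mul (hϑ.continuousOn.sub hlog)

/-- The comparison integrand `B(t) = (f_n − (1 − cos(n/t))) log(t/2π)` is continuous on `[a, b]`, `a > 0`. -/
theorem continuousOn_B (n : ℕ) {a b : ℝ} (ha : 0 < a) :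
    ContinuousOn (fun t ↦ (liWindowWeight n t - (1 - Real.cos (n / t))) * Real.log (t / (2 * π))) (Icc a b) := by
  have hne : ∀ t ∈ Icc a b, t ≠ 0 := fun t ht ↦ by linarith [ht.1]
  have hf := continuousOn_liWindowWeight n hne
  have hg : ContinuousOn (fun t : ℝ ↦ 1 - Real.cos (n / t)) (Icc a b) := by
    refine continuousOn_of_forall_continuousAt fun t ht ↦ ?_
    have := hne t ht
    fun_prop (disch := assumption)
  have hlog : ContinuousOn (fun t : ℝ ↦ Real.log (t / (2 * π))) (Icc a b) := by
    refine continuousOn_of_forall_continuousAt fun t ht ↦ ?_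
    have : t / (2 * π) ≠ 0 := by have : 0 < t := by linarith [ht.1]
                                 positivity
    fun_prop (disch := assumption)
  exact (hf.sub hg).mul hlog

/-! ### The two integral estimates -/

/-- (6a) `|∫_a^b 2 f_n (ϑ' − ½ log(t/2π))| ≤ 8 log(b/a)` using `f_n ≤ 2` (`1 ≤ a ≤ b`). -/
theorem abs_integral_A_low (n : ℕ) {a b : ℝ} (ha : 1 ≤ a) (hab : a ≤ b) :
    |∫ t in a..b, 2 * liWindowWeight n t * (riemannSiegelThetaDeriv t - Real.log (t / (2 * π)) / 2)| ≤
      8 * Real.log (b / a) := by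
  have ha0 : 0 < a := by linarith
  have hle : ∀ᵐ t ∂volume, t ∈ Ioc a b →
      ‖2 * liWindowWeight n t * (riemannSiegelThetaDeriv t - Real.log (t / (2 * π)) / 2)‖ ≤ 8 * t⁻¹ :=
    Filter.Eventually.of_forall fun t ht ↦ by
      have ht1 : 1 ≤ t := by linarith [ht.1]
      have ht0 : 0 < t := by linarith
      rw [Real.norm_eq_abs, abs_mul, abs_mul, abs_two]
      obtain ⟨hf0, hf2⟩ := liWindowWeight_mem n t
      rw [abs_of_nonneg hf0]
      have hE := abs_riemannSiegelThetaDeriv_sub_log_le ht1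
      calc 2 * liWindowWeight n t * |riemannSiegelThetaDeriv t - Real.log (t / (2 * π)) / 2|
          ≤ 2 * 2 * (2 / t) := mul_le_mul (by linarith) hE (abs_nonneg _) (by norm_num)
        _ = 8 * t⁻¹ := by ring
  have hint : IntervalIntegrable (fun t : ℝ ↦ 8 * t⁻¹) volume a b := by
    refine (continuousOn_of_forall_continuousAt fun t ht ↦ ?_).intervalIntegrable
    rw [uIcc_of_le hab] at ht
    have ht0 : t ≠ 0 := by linarith [ht.1]
    fun_prop (disch := assumption)
  have h := intervalIntegral.norm_integral_le_of_norm_le hab hle hint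
  rw [intervalIntegral.integral_const_mul, integral_inv_of_pos ha0 (by linarith), Real.norm_eq_abs] at h
  exact h

/-- (6a) `|∫_a^b 2 f_n (ϑ' − ½ log(t/2π))| ≤ n² (1/a² − 1/b²)` using `f_n ≤ n²/(2t²)` (`1 ≤ a ≤ b`). -/
theorem abs_integral_A_high (n : ℕ) {a b : ℝ} (ha : 1 ≤ a) (hab : a ≤ b) :
    |∫ t in a..b, 2 * liWindowWeight n t * (riemannSiegelThetaDeriv t - Real.log (t / (2 * π)) / 2)| ≤
      (n : ℝ) ^ 2 * ((a ^ 2)⁻¹ - (b ^ 2)⁻¹) := by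
  have ha0 : 0 < a := by linarith
  have hb0 : 0 < b := by linarith
  have hle : ∀ᵐ t ∂volume, t ∈ Ioc a b →
      ‖2 * liWindowWeight n t * (riemannSiegelThetaDeriv t - Real.log (t / (2 * π)) / 2)‖ ≤
        (n : ℝ) ^ 2 * (2 / t ^ 3) :=
    Filter.Eventually.of_forall fun t ht ↦ by
      have ht1 : 1 ≤ t := by linarith [ht.1]
      have ht0 : 0 < t := by linarith
      rw [Real.norm_eq_abs, abs_mul, abs_mul, abs_two]
      obtain ⟨hf0, -⟩ := liWindowWeight_mem n t
      rw [abs_of_nonneg hf0]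
      have hE := abs_riemannSiegelThetaDeriv_sub_log_le ht1
      have hf := liWindowWeight_le_sq n ht0
      calc 2 * liWindowWeight n t * |riemannSiegelThetaDeriv t - Real.log (t / (2 * π)) / 2|
          ≤ 2 * ((n : ℝ) ^ 2 / (2 * t ^ 2)) * (2 / t) :=
            mul_le_mul (by linarith) hE (abs_nonneg _) (by positivity)
        _ = (n : ℝ) ^ 2 * (2 / t ^ 3) := by field_simp
  have hcont : ContinuousOn (fun t : ℝ ↦ (n : ℝ) ^ 2 * (2 / t ^ 3)) (uIcc a b) := by
    refine continuousOn_of_forall_continuousAt fun t ht ↦ ?_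
    rw [uIcc_of_le hab] at ht
    have ht0 : t ≠ 0 := by linarith [ht.1]
    have ht3 : t ^ 3 ≠ 0 := pow_ne_zero 3 ht0
    fun_prop (disch := assumption)
  have h := intervalIntegral.norm_integral_le_of_norm_le hab hle hcont.intervalIntegrable
  have hFTC : ∫ t in a..b, (n : ℝ) ^ 2 * (2 / t ^ 3) = (n : ℝ) ^ 2 * ((a ^ 2)⁻¹ - (b ^ 2)⁻¹) := by
    rw [intervalIntegral.integral_const_mul]
    congr 1
    have hderiv : ∀ t ∈ uIcc a b, HasDerivAt (fun y : ℝ ↦ -(y ^ 2)⁻¹) (2 / t ^ 3) t := by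
      intro t ht
      rw [uIcc_of_le hab] at ht
      have ht0 : t ≠ 0 := by linarith [ht.1]
      exact (hasDerivAt_inv_sq ht0).neg.congr_deriv (by ring)
    have hci : ContinuousOn (fun t : ℝ ↦ 2 / t ^ 3) (uIcc a b) := by
      refine continuousOn_of_forall_continuousAt fun t ht ↦ ?_
      rw [uIcc_of_le hab] at ht
      have ht0 : t ≠ 0 := by linarith [ht.1]
      have ht3 : t ^ 3 ≠ 0 := pow_ne_zero 3 ht0
      fun_prop (disch := assumption)
    rw [intervalIntegral.integral_eq_sub_of_hasDerivAt hderiv hci.intervalIntegrable]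
    ring
  rw [hFTC, Real.norm_eq_abs] at h
  exact h

/-- (6b) `|∫_a^b (f_n − (1 − cos(n/t))) log(t/2π)| ≤ (n/12)((2 log a + 1)/(4a²) − (2 log b + 1)/(4b²))`
(`2π ≤ a ≤ b`). -/
theorem abs_integral_B (n : ℕ) {a b : ℝ} (ha : 2 * π ≤ a) (hab : a ≤ b) :
    |∫ t in a..b, (liWindowWeight n t - (1 - Real.cos (n / t))) * Real.log (t / (2 * π))| ≤
      (n : ℝ) / 12 * ((2 * Real.log a + 1) / (4 * a ^ 2) - (2 * Real.log b + 1) / (4 * b ^ 2)) := by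
  have hπ := Real.pi_pos
  have ha0 : 0 < a := by linarith [Real.pi_gt_three]
  have hle : ∀ᵐ t ∂volume, t ∈ Ioc a b →
      ‖(liWindowWeight n t - (1 - Real.cos (n / t))) * Real.log (t / (2 * π))‖ ≤
        (n : ℝ) / 12 * (Real.log t / t ^ 3) :=
    Filter.Eventually.of_forall fun t ht ↦ by
      have ht0 : 0 < t := by linarith [ht.1]
      have ht2π : 2 * π ≤ t := by linarith [ht.1]
      rw [Real.norm_eq_abs, abs_mul]
      have hℓ0 : 0 ≤ Real.log (t / (2 * π)) := Real.log_nonneg (by rw [le_div_iff₀ (by positivity)]; linarith)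
      have hℓ : Real.log (t / (2 * π)) ≤ Real.log t := by
        rw [Real.log_div ht0.ne' (by positivity)]
        linarith [Real.log_nonneg (by linarith [Real.pi_gt_three] : (1 : ℝ) ≤ 2 * π)]
      rw [abs_of_nonneg hℓ0]
      calc |liWindowWeight n t - (1 - Real.cos (n / t))| * Real.log (t / (2 * π))
          ≤ (n : ℝ) / (12 * t ^ 3) * Real.log t :=
            mul_le_mul (abs_liWindowWeight_sub_model_le n ht0) hℓ hℓ0 (by positivity)
        _ = (n : ℝ) / 12 * (Real.log t / t ^ 3) := by field_simp
  have hcont : ContinuousOn (fun t : ℝ ↦ (n : ℝ) / 12 * (Real.log t / t ^ 3)) (uIcc a b) := by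
    refine continuousOn_of_forall_continuousAt fun t ht ↦ ?_
    rw [uIcc_of_le hab] at ht
    have ht0 : t ≠ 0 := by linarith [ht.1]
    have ht3 : t ^ 3 ≠ 0 := pow_ne_zero 3 ht0
    fun_prop (disch := assumption)
  have h := intervalIntegral.norm_integral_le_of_norm_le hab hle hcont.intervalIntegrable
  have hFTC : ∫ t in a..b, (n : ℝ) / 12 * (Real.log t / t ^ 3) =
      (n : ℝ) / 12 * ((2 * Real.log a + 1) / (4 * a ^ 2) - (2 * Real.log b + 1) / (4 * b ^ 2)) := by
    rw [intervalIntegral.integral_const_mul]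
    congr 1
    have hderiv : ∀ t ∈ uIcc a b, HasDerivAt (fun y : ℝ ↦ -((2 * Real.log y + 1) / (4 * y ^ 2)))
        (Real.log t / t ^ 3) t := by
      intro t ht
      rw [uIcc_of_le hab] at ht
      have ht0 : t ≠ 0 := by linarith [ht.1]
      have h1 : HasDerivAt (fun y : ℝ ↦ 2 * Real.log y + 1) (2 * t⁻¹) t := by
        simpa using ((Real.hasDerivAt_log ht0).const_mul 2).add_const 1
      have h2 : HasDerivAt (fun y : ℝ ↦ 4 * y ^ 2) (4 * (2 * t)) t := by
        simpa using (hasDerivAt_pow 2 t).const_mul 4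
      have h := (h1.div h2 (by positivity)).neg
      refine h.congr_deriv ?_
      field_simp
      ring
    have hci : ContinuousOn (fun t : ℝ ↦ Real.log t / t ^ 3) (uIcc a b) := by
      refine continuousOn_of_forall_continuousAt fun t ht ↦ ?_
      rw [uIcc_of_le hab] at ht
      have ht0 : t ≠ 0 := by linarith [ht.1]
      have ht3 : t ^ 3 ≠ 0 := pow_ne_zero 3 ht0
      fun_prop (disch := assumption)
    rw [intervalIntegral.integral_eq_sub_of_hasDerivAt hderiv hci.intervalIntegrable]
    ring
  rw [hFTC, Real.norm_eq_abs] at h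
  exact h

end SmoothReplace

open SmoothReplace in
/-- **Stub K2b `stub_replace` of crux `LiSmoothMainTerm`** (route `LiAsymptotic`, stmt-RiemannHypothesis-19162;
RH-FREE): for `n ≥ 100`, `T' ≥ n²`,
`|(2/π)∫_{√n}^{T'} f_n ϑ' − (1/π)∫_{√n}^{T'} (1 − cos(n/t)) log(t/2π)| ≤ 1.28 log n + 0.33`.  Verbatim the registered
signature `Sig.stub_replace`. -/
theorem liSmoothReplace_bound :
    ∀ (n : ℕ) (T' : ℝ), 100 ≤ n → (n : ℝ) ^ 2 ≤ T' →
      |2 / Real.pi * (∫ t in Real.sqrt n..T', liWindowWeight n t * riemannSiegelThetaDeriv t) -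
        1 / Real.pi * (∫ t in Real.sqrt n..T', (1 - Real.cos (n / t)) * Real.log (t / (2 * Real.pi)))| ≤
        1.28 * Real.log n + 0.33 := by
  intro n T' hn hT'
  have hπ := Real.pi_pos
  have hπ3 := Real.pi_gt_d4
  have hπ4 := Real.pi_lt_d2
  have hnR : (100 : ℝ) ≤ n := by exact_mod_cast hn
  have hn0 : (0 : ℝ) ≤ n := by positivity
  set a := Real.sqrt n with ha
  have haa : a ^ 2 = n := by rw [ha, Real.sq_sqrt hn0]
  have ha10 : 10 ≤ a := by
    have h10 : Real.sqrt ((10 : ℝ) ^ 2) = 10 := Real.sqrt_sq (by norm_num)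
    rw [ha, ← h10]
    exact Real.sqrt_le_sqrt (by linarith)
  have ha0 : 0 < a := by linarith
  have ha1 : 1 ≤ a := by linarith
  have ha2π : 2 * π ≤ a := by linarith
  have hloga : Real.log a = Real.log n / 2 := by rw [ha, Real.log_sqrt hn0]
  set m : ℝ := (n : ℝ) / 2 with hm
  have ham : a ≤ m := by rw [hm]; nlinarith
  have hmT : m ≤ T' := by rw [hm]; nlinarith
  have haT : a ≤ T' := ham.trans hmT
  have hm1 : 1 ≤ m := ha1.trans ham
  -- the integrands
  set F : ℝ → ℝ := fun t ↦ liWindowWeight n t * riemannSiegelThetaDeriv t with hF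
  set G : ℝ → ℝ := fun t ↦ (1 - Real.cos (n / t)) * Real.log (t / (2 * π)) with hG
  set A : ℝ → ℝ := fun t ↦ 2 * liWindowWeight n t * (riemannSiegelThetaDeriv t - Real.log (t / (2 * π)) / 2)
    with hA
  set B : ℝ → ℝ := fun t ↦ (liWindowWeight n t - (1 - Real.cos (n / t))) * Real.log (t / (2 * π)) with hB
  -- integrability on `[a, T']`
  have hne : ∀ t ∈ Icc a T', t ≠ 0 := fun t ht ↦ by linarith [ht.1]
  have hFc : ContinuousOn F (uIcc a T') := by
    rw [uIcc_of_le haT]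
    exact (continuousOn_liWindowWeight n hne).mul continuous_riemannSiegelThetaDeriv_holds.continuousOn
  have hGc : ContinuousOn G (uIcc a T') := by
    rw [uIcc_of_le haT]
    refine continuousOn_of_forall_continuousAt fun t ht ↦ ?_
    have h1 : t ≠ 0 := hne t ht
    have h0 : 0 < t := by linarith [ht.1]
    have h2 : t / (2 * π) ≠ 0 := by positivity
    show ContinuousAt (fun t : ℝ ↦ (1 - Real.cos (n / t)) * Real.log (t / (2 * π))) t
    fun_prop (disch := assumption)
  have hAi : ∀ x y : ℝ, a ≤ x → x ≤ y → IntervalIntegrable A volume x y := fun x y hx hxy ↦ by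
    have := continuousOn_A n (a := x) (b := y) (by linarith)
    rw [← uIcc_of_le hxy] at this
    exact this.intervalIntegrable
  have hBc : ContinuousOn B (uIcc a T') := by rw [uIcc_of_le haT]; exact continuousOn_B n ha0
  -- the pointwise identity `2F − G = A + B`
  have hid : 2 / π * (∫ t in a..T', F t) - 1 / π * (∫ t in a..T', G t) =
      1 / π * ((∫ t in a..T', A t) + ∫ t in a..T', B t) := by
    rw [← intervalIntegral.integral_add (hAi a T' le_rfl haT) hBc.intervalIntegrable,
      show 2 / π * (∫ t in a..T', F t) = 1 / π * (2 * ∫ t in a..T', F t) by ring,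
      ← mul_sub, ← intervalIntegral.integral_const_mul,
      ← intervalIntegral.integral_sub (hFc.intervalIntegrable.const_mul 2) hGc.intervalIntegrable]
    congr 1
    refine intervalIntegral.integral_congr fun t _ ↦ ?_
    simp only [hF, hG, hA, hB]
    ring
  rw [hid, abs_mul, abs_of_pos (by positivity : (0 : ℝ) < 1 / π)]
  -- (6a): split `∫ A` at `m = n/2`
  have hAsplit : ∫ t in a..T', A t = (∫ t in a..m, A t) + ∫ t in m..T', A t :=
    (intervalIntegral.integral_add_adjacent_intervals (hAi a m le_rfl ham) (hAi m T' ham hmT)).symm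
  have hA1 := abs_integral_A_low n ha1 ham
  have hA2 := abs_integral_A_high n hm1 hmT
  have hlogm : Real.log (m / a) = Real.log n - Real.log 2 - Real.log n / 2 := by
    rw [Real.log_div (by positivity) ha0.ne', hm, Real.log_div (by positivity) (by norm_num), hloga]
  rw [hlogm] at hA1
  have hA2' : (n : ℝ) ^ 2 * ((m ^ 2)⁻¹ - (T' ^ 2)⁻¹) ≤ 4 := by
    have h1 : (n : ℝ) ^ 2 * (m ^ 2)⁻¹ = 4 := by rw [hm]; field_simp; ring
    have h2 : 0 ≤ (n : ℝ) ^ 2 * (T' ^ 2)⁻¹ := by positivity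
    nlinarith
  -- (6b)
  have hB1 := abs_integral_B n ha2π haT
  have hB1' : (n : ℝ) / 12 * ((2 * Real.log a + 1) / (4 * a ^ 2) - (2 * Real.log T' + 1) / (4 * T' ^ 2)) ≤
      (Real.log n + 1) / 48 := by
    have hT0 : 0 < T' := by linarith
    have hlT : 0 ≤ Real.log T' := Real.log_nonneg (by linarith)
    have h2 : 0 ≤ (n : ℝ) / 12 * ((2 * Real.log T' + 1) / (4 * T' ^ 2)) := by positivity
    have h1 : (n : ℝ) / 12 * ((2 * Real.log a + 1) / (4 * a ^ 2)) = (Real.log n + 1) / 48 := by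
      rw [hloga, haa]; field_simp; ring
    nlinarith
  -- assemble
  have hl2 := Real.log_two_gt_d9
  have hlogn : 0 ≤ Real.log n := Real.log_nonneg (by linarith)
  have htot : |(∫ t in a..T', A t) + ∫ t in a..T', B t| ≤ 4 * Real.log n - 8 * Real.log 2 + 4 + (Real.log n + 1) / 48 := by
    rw [hAsplit]
    refine (abs_add_le _ _).trans ?_
    have := (abs_add_le _ _).trans (add_le_add hA1 (hA2.trans hA2'))
    linarith [hB1.trans hB1']
  have hkey : 1 / π * (4 * Real.log n - 8 * Real.log 2 + 4 + (Real.log n + 1) / 48) ≤ 1.28 * Real.log n + 0.33 := by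
    rw [div_mul_eq_mul_div, one_mul, div_le_iff₀ hπ]
    nlinarith
  exact (mul_le_mul_of_nonneg_left htot (by positivity)).trans hkey

end Summit.RiemannHypothesis.RiemannHypothesis.Theorems.LiTheory

end
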